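import Literature.ModelTheory.ExponentialFields.DefinablyCompleteSignSets
import Literature.ModelTheory.ExponentialFields.OEFDCZeroBoundSentences
import HarnessLib

/-!
# `OEF ∪ [DC]` proves the uniform bounds on the components of `{F > 0}` for one-variable exponential polynomials

Topic `Literature/ModelTheory/ExponentialFields`.  The axioms of Berarducci–Servi's recursive
o-minimal subtheory `T_omin ⊆ T_exp` (Ann. Pure Appl. Logic 125 (2004), Def. 2.1, Cor. 2.5)
bound, uniformly in the parameters, the number of connected components of the definable
subsets of the line.  For the sets `{x | F_ā(x) > 0}`, `F_ā = Σ_{j<n} (Σ_{i≤d} a_{j,i} xⁱ) exp(x)ʲ`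
a one-variable exponential polynomial, such a bound is the first-order sentence

* **`altBoundSentence n d`** (`AB_{n,d}`): "for all `ā` there are no points
  `x₀ < y₀ < x₁ < y₁ < ⋯ < y_B < x_{B+1}` (`B = n(d+1)`) with `F_ā(x_k) > 0` and
  `F_ā(y_k) ≤ 0`" — i.e. `{F_ā > 0}` meets at most `B + 1` maximal order-convex pieces,

and this file proves it *in* the recursive theory `OEFDC = OEF ∪ [DC] ⊆ Th(ℝ_exp)`
(**`OEFDC_models_altBoundSentence`**), through **`OEFModel.realize_altBoundSentence`** (every
definably complete model of `OEF` satisfies `AB_{n,d}`): each alternation `F(x_k) > 0 ≥ F(y_k)`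
yields a zero in `(x_k, y_k]` by the definable intermediate value theorem, whence `B + 1`
distinct zeros, impossible for a nonzero `F_ā` by the zero bound of
`OEFDefinablyCompleteZeros.lean` (`≤ B - 1` zeros), while `F_ā = 0` contradicts `F_ā(x₀) > 0`.
This is the `cc`-bound form (Fornasiero–Servi 2010, Thm. 7.7: "`γ(A) < ∞` for every quantifier
free definable `A`", here with the explicit uniform bound) complementing the zero bound
`ZB_{n,d}` of `OEFDCZeroBoundSentences.lean`; `altBoundSentence_mem_realExpTheory` records
`AB_{n,d} ∈ Th(ℝ_exp)`.

Everything is proved; the definitions are the formula `altFormula` and the sentence.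

## References

* A. Berarducci, T. Servi, Ann. Pure Appl. Logic 125 (2004), Definition 2.1, Corollary 2.5.
  [BerarducciServi2004]
* A. Fornasiero, T. Servi, Fund. Math. 209 (2010), Theorem 7.7, Theorem 8.2, Corollary 8.3.
  [FornasieroServi2010]
-/

noncomputable section

open Set FirstOrder FirstOrder.Language FirstOrder.Language.Structure Polynomial
open scoped FirstOrder

namespace Literature.ModelTheory.ExponentialFields

universe w

namespace UnaryExpPoly

/-! ### The sentence -/

/-- The alternation formula: `x₀ < y₀ < x₁ < ⋯ < y_B < x_{B+1}`, `F_ā(x_k) > 0`, `F_ā(y_k) ≤ 0`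
(`B = n(d+1)`), in the coefficient variables `ā` and the point variables `x̄ ⊕ ȳ`. [folklore] -/
def altFormula (n d : ℕ) :
    Language.orderedExpRing.Formula
      ((Empty ⊕ (Fin n × Fin (d + 1))) ⊕ (Fin (zeroBound n d + 2) ⊕ Fin (zeroBound n d + 1))) :=
  let V := (Empty ⊕ (Fin n × Fin (d + 1))) ⊕ (Fin (zeroBound n d + 2) ⊕ Fin (zeroBound n d + 1))
  let a : Fin n × Fin (d + 1) → Language.orderedExpRing.Term V := fun c => var (Sum.inl (Sum.inr c))
  let x : Fin (zeroBound n d + 2) → Language.orderedExpRing.Term V := fun k => var (Sum.inr (Sum.inl k))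
  let y : Fin (zeroBound n d + 1) → Language.orderedExpRing.Term V := fun k => var (Sum.inr (Sum.inr k))
  (Formula.iInf fun k : Fin (zeroBound n d + 1) =>
      ((x k.castSucc).relabel Sum.inl).lt ((y k).relabel Sum.inl) ⊓
        ((y k).relabel Sum.inl).lt ((x k.succ).relabel Sum.inl)) ⊓
    ((Formula.iInf fun k : Fin (zeroBound n d + 2) =>
        (Term.relabel Sum.inl (0 : Language.orderedExpRing.Term V)).lt
          ((fTerm n d a (x k)).relabel Sum.inl)) ⊓
      (Formula.iInf fun k : Fin (zeroBound n d + 1) =>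
        ((fTerm n d a (y k)).relabel Sum.inl).le
          (Term.relabel Sum.inl (0 : Language.orderedExpRing.Term V))))

/-- **The alternation-bound sentence** `AB_{n,d}`: "for all `ā`, no alternation
`x₀ < y₀ < ⋯ < y_B < x_{B+1}` with `F_ā(x_k) > 0 ≥ F_ā(y_k)`" (`B = n(d+1)`), an instance of the
uniform bounds on connected components axiomatizing Berarducci–Servi's `T_omin` (2004, Def. 2.1,
Cor. 2.5). [cite: BerarducciServi2004, Corollary 2.5] -/
def altBoundSentence (n d : ℕ) : Language.orderedExpRing.Sentence :=
  Formula.iAlls (Fin n × Fin (d + 1))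
    (∼(Formula.iExs (Fin (zeroBound n d + 2) ⊕ Fin (zeroBound n d + 1)) (altFormula n d)))

/-- **Semantics of `AB_{n,d}` in a model of `OEF`.** [folklore] -/
theorem realize_altBoundSentence_iff (K : Language.Theory.ModelType.{0, 0, w} Theory.OEF)
    (n d : ℕ) :
    K ⊨ altBoundSentence n d ↔
      ∀ c : Fin n × Fin (d + 1) → K,
        ¬ ∃ w : Fin (zeroBound n d + 2) ⊕ Fin (zeroBound n d + 1) → K,
          (∀ k : Fin (zeroBound n d + 1),
              w (Sum.inl k.castSucc) < w (Sum.inr k) ∧ w (Sum.inr k) < w (Sum.inl k.succ)) ∧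
            (∀ k : Fin (zeroBound n d + 2),
                0 < eval OEFModel.exp (coeffPoly n d c) n (w (Sum.inl k))) ∧
              ∀ k : Fin (zeroBound n d + 1),
                eval OEFModel.exp (coeffPoly n d c) n (w (Sum.inr k)) ≤ 0 := by
  simp only [altBoundSentence, altFormula, Sentence.Realize, Formula.realize_iAlls,
    Formula.realize_not, Formula.realize_iExs, Formula.realize_inf, Formula.realize_iInf]
  refine forall_congr' fun c => not_congr (exists_congr fun w => ?_)
  simp [Formula.Realize, Term.realize_lt, Term.realize_le, realize_fTerm]

/-! ### `AB_{n,d}` holds in the definably complete models of `OEF` -/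

/-- **`AB_{n,d}` holds in every definably complete model of `OEF`.** Each alternation
`F(x_k) > 0 ≥ F(y_k)` produces a zero of `F` in `(x_k, y_k]` (definable intermediate value
theorem), so `B + 1` distinct zeros; a nonzero `F_ā` has at most `B - 1`
(`OEFModel.finite_setOf_unaryExpPoly_eq_zero`, `budget_coeffPoly_le`), and `F_ā = 0`
contradicts `F_ā(x₀) > 0`. [cite: FornasieroServi2010, Theorem 7.7] -/
theorem _root_.Literature.ModelTheory.ExponentialFields.OEFModel.realize_altBoundSentence
    (K : Language.Theory.ModelType.{0, 0, w} Theory.OEF)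
    (hDC : Language.orderedExpRing.IsDefinablyComplete K) (n d : ℕ) :
    K ⊨ altBoundSentence n d := by
  rw [realize_altBoundSentence_iff]
  rintro c ⟨w, hchain, hpos, hnonpos⟩
  set F : K → K := fun t => eval OEFModel.exp (coeffPoly n d c) n t with hF
  letI : TopologicalSpace K := Preorder.topology K
  haveI : OrderTopology K := ⟨rfl⟩
  have hcont : Continuous F := continuous_iff_continuousAt.2 fun t =>
    (OEFModel.isOrderedExp_exp.hasFieldDerivAt_unaryExpPoly (coeffPoly n d c) n t).continuousAt
  have hgraph := OEFModel.definable_graph_unaryExpPoly K (coeffPoly n d c) n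
  -- a zero in each `(x_k, y_k]`
  have hzero : ∀ k : Fin (zeroBound n d + 1), ∃ z, w (Sum.inl k.castSucc) < z ∧
      z ≤ w (Sum.inr k) ∧ F z = 0 := by
    intro k
    obtain ⟨z, hz, hFz⟩ := hDC.exists_mem_Icc_eq_of_continuousOn (OEFModel.definable_lt K)
      (definable_graph_neg definable_graph_add hgraph) (hchain k).1.le hcont.neg.continuousOn
      (y := 0) (by simpa using (hpos k.castSucc).le) (by simpa using hnonpos k)
    have hFz0 : F z = 0 := by simpa using hFz
    refine ⟨z, lt_of_le_of_ne hz.1 fun h => (hpos k.castSucc).ne' ?_, hz.2, hFz0⟩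
    rw [h]
    exact hFz0
  choose z hz using hzero
  -- the zeros are strictly increasing, hence distinct
  have hxmono : StrictMono fun k : Fin (zeroBound n d + 2) => w (Sum.inl k) :=
    (Fin.strictMono_iff_lt_succ (f := fun k => w (Sum.inl k))).2 fun k =>
      (hchain k).1.trans (hchain k).2
  have hzmono : StrictMono z := by
    refine (Fin.strictMono_iff_lt_succ (f := z)).2 fun k => ?_
    calc z k.castSucc ≤ w (Sum.inr k.castSucc) := (hz k.castSucc).2.1
      _ < w (Sum.inl k.castSucc.succ) := (hchain k.castSucc).2
      _ = w (Sum.inl k.succ.castSucc) := by rw [Fin.succ_castSucc]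
      _ < z k.succ := (hz k.succ).1
  by_cases hP : ∃ j < n, coeffPoly n d c j ≠ 0
  · obtain ⟨hfin, hcard⟩ := OEFModel.finite_setOf_unaryExpPoly_eq_zero K hDC _ n hP
    have hbud := budget_coeffPoly_le n d c
    have hsub : ((Finset.univ.image z : Finset K) : Set K) ⊆
        {t : K | eval OEFModel.exp (coeffPoly n d c) n t = 0} := by
      intro t ht
      obtain ⟨k, -, rfl⟩ := Finset.mem_image.1 (Finset.mem_coe.1 ht)
      exact (hz k).2.2
    have hle := Set.ncard_le_ncard hsub hfin
    rw [Set.ncard_coe_finset, Finset.card_image_of_injective _ hzmono.injective,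
      Finset.card_univ, Fintype.card_fin] at hle
    have hbpos : 0 < budget (coeffPoly n d c) n := by
      obtain ⟨j, hj, hPj⟩ := hP
      exact budget_pos hj hPj
    omega
  · push Not at hP
    have h0 := eval_coeffPoly_eq_zero_of_forall (E := OEFModel.exp) hP (w (Sum.inl 0))
    exact (hpos 0).ne' h0

/-- **`OEFDC ⊨ AB_{n,d}`**: the recursive subtheory `OEF ∪ [DC]` of `Th(ℝ_exp)` proves the
uniform bounds on the alternations (components) of `{F_ā > 0}` for one-variable exponential
polynomials. [cite: FornasieroServi2010, Corollary 8.3] -/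
theorem _root_.Literature.ModelTheory.ExponentialFields.OEFDC_models_altBoundSentence (n d : ℕ) :
    Theory.OEFDC ⊨ᵇ altBoundSentence n d := by
  rw [Theory.models_sentence_iff]
  intro M
  exact OEFModel.realize_altBoundSentence (OEFDCModel.toOEF M) (OEFDCModel.isDefinablyComplete M)
    n d

/-- `ℝ_exp ⊨ AB_{n,d}`. [folklore] -/
theorem _root_.Literature.ModelTheory.ExponentialFields.Real.realize_altBoundSentence (n d : ℕ) :
    ℝ ⊨ altBoundSentence n d :=
  OEFModel.realize_altBoundSentence (Theory.ModelType.of Theory.OEF ℝ) real_isDefinablyComplete n d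

/-- `AB_{n,d} ∈ Th(ℝ_exp)`. [folklore] -/
theorem _root_.Literature.ModelTheory.ExponentialFields.altBoundSentence_mem_realExpTheory
    (n d : ℕ) : altBoundSentence n d ∈ realExpTheory :=
  Language.mem_completeTheory.2 (Real.realize_altBoundSentence n d)

end UnaryExpPoly

end Literature.ModelTheory.ExponentialFields
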